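import Mathlib.Analysis.Complex.Exponential
import Mathlib.Analysis.SpecialFunctions.Exp
import Literature.Barriers.ValiantsHypothesis.ShiftedPartialsTwoPowers
import HarnessLib

/-!
# Shifted partial derivatives: Case C3 of Efremenko–Landsberg–Schenck–Weyman's Theorem 1.5
(small order, large shift)

Support file for the barrier entry `ShiftedPartialDerivatives.lean` (`ShiftedPartialsCannotSeparate`,
ELSW Thm. 1.5). **Printed Case C3** (§1.3, §5): "Case `k < 2m` and `τ > (3/2)n²m`": with `R = ℓ₁ⁿ+ℓ₂ⁿ`
(`ShiftedPartialsTwoPowers.lean`) "we need to show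
`2 binom(n²+τ-1,τ) - binom(n²+τ+m-1,τ+m) - binom(n²+τ-(n-k)-1, τ-(n-k)) > 0`. Divide by
`binom(n²+τ-1,τ)` ... `2 > Π_{j=1}^m (1 + n²/(τ+m-j)) + Π_{j=1}^{n-k} (1 - n²/(n²+τ-j))` ... bounded above
by `e^{1/δ} + e^{2/δ-n/(mδ)}` (`τ = n²mδ`). The second term goes to zero for large `m`, so we just need the
first term to be less than `2`, so we take, e.g. `δ = 3/2`." The printed estimate is asymptotic ("for
large `m`"); this file proves it with EXPLICIT constants: `m ≥ 10`, `n > 2m²+2m`, `0 < k`, `2k < 3m`,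
`3n²m ≤ 2τ` (`caseC3`, characteristic zero). The order range is narrowed from the printed `k < 2m` to
`2k < 3m` because with the printed constants Cases C3 and C4 do not overlap when `2m²+2m < n ≲ 3m²`
(§1.3 announces C4 for `τ < 6n³/m`, §6 delivers `τ < n³/(6m)`); in the tree's assembly the orders
`3m ≤ 2k ≤ 2(n-2m+1)` are given to Case C2 instead (Macaulay's theorem reaches them).

* `exp_add_exp_lt_two`: `e^{Mx} + e^{-Sx/(1+x)} < 2` for `M ≥ 10`, `S ≥ 20M`, `0 < x`, `3Mx ≤ 2`
  (Taylor pieces and numerical values of `exp` from Mathlib's `Real.exp_bound`).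
* `choose_add_choose_lt_two_mul_choose`: the displayed binomial inequality, for `m ≥ 10`, `s = n-k ≥ 20m`,
  `s ≤ τ`, `N ≥ 2`, `3Nm ≤ 2τ` (ratios of binomials as products, `(1+x)^m ≤ e^{mx}`,
  `(1-y)^s ≤ e^{-sy}`).
* `caseC3`: `rank P ≤ dim S^{m+τ} < 2 dim S^τ - dim S^{τ-(n-k)} ≤ rank(ℓ₁ⁿ ± ℓ₂ⁿ) ≤ rank det_n`
  (`shiftedPartialsRank_paddedPerPoly_le_choose`, `le_shiftedPartialsRank_two_powers`,
  `X_pow_add_mem_endOrbit`, `shiftedPartialsRank_le_of_mem_endOrbit`).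

## References

* [EfremenkoLandsbergSchenckWeyman2018] K. Efremenko, J. M. Landsberg, H. Schenck, J. Weyman,
  *The method of shifted partial derivatives cannot separate the permanent from the determinant*,
  Math. Comp. 87 (2018) 2037–2045, §1.3 and §5 (Case C3).
-/

noncomputable section

namespace Literature.Barriers.ValiantsHypothesis

open MvPolynomial Literature.Computability.AlgebraicComplexity

section Analysis
open Real

/-! ### Numerical bounds for the exponential -/

/-- `e^{0.3} ≤ 1.35` (Taylor bound, Mathlib's `Real.exp_bound'`). [folklore] -/
theorem exp_three_tenths_le : Real.exp (3 / 10) ≤ 1.35 := by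
  have h := Real.exp_bound' (x := 3 / 10) (by norm_num) (by norm_num) (n := 5) (by norm_num)
  refine h.trans ?_
  simp only [Finset.sum_range_succ, Finset.sum_range_zero, Nat.factorial]
  norm_num

/-- `e^{0.55} ≤ 1.7334`. [folklore] -/
theorem exp_eleven_twentieths_le : Real.exp (11 / 20) ≤ 1.7334 := by
  have h := Real.exp_bound' (x := 11 / 20) (by norm_num) (by norm_num) (n := 5) (by norm_num)
  refine h.trans ?_
  simp only [Finset.sum_range_succ, Finset.sum_range_zero, Nat.factorial]
  norm_num

/-- `e^{2/3} ≤ 1.9479`. [folklore] -/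
theorem exp_two_thirds_le : Real.exp (2 / 3) ≤ 1.9479 := by
  have h := Real.exp_bound' (x := 2 / 3) (by norm_num) (by norm_num) (n := 6) (by norm_num)
  refine h.trans ?_
  simp only [Finset.sum_range_succ, Finset.sum_range_zero, Nat.factorial]
  norm_num

/-- `e^{-v} ≤ 1 / (1 + v + v²/2 + v³/6)` for `v ≥ 0`. [folklore] -/
theorem exp_neg_le_inv_cubic {v : ℝ} (hv : 0 ≤ v) :
    Real.exp (-v) ≤ (1 + v + v ^ 2 / 2 + v ^ 3 / 6)⁻¹ := by
  have h := Real.sum_le_exp_of_nonneg hv 4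
  simp only [Finset.sum_range_succ, Finset.sum_range_zero, Nat.factorial] at h
  norm_num at h
  rw [Real.exp_neg]
  have hpos : 0 < 1 + v + v ^ 2 / 2 + v ^ 3 / 6 := by positivity
  exact inv_anti₀ hpos (by linarith)

/-- `e^{-v} ≤ 1 - v + (13/18) v²` for `0 ≤ v ≤ 1` (third-order Taylor remainder). [folklore] -/
theorem exp_neg_le_taylor {v : ℝ} (hv0 : 0 ≤ v) (hv1 : v ≤ 1) :
    Real.exp (-v) ≤ 1 - v + 13 / 18 * v ^ 2 := by
  have h := Real.exp_bound (x := -v) (by rw [abs_neg, abs_of_nonneg hv0]; exact hv1) (n := 3)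
    (by norm_num)
  simp only [Finset.sum_range_succ, Finset.sum_range_zero, Nat.factorial] at h
  rw [abs_neg, abs_of_nonneg hv0] at h
  have h' := (abs_sub_le_iff.1 h).1
  norm_num at h'
  nlinarith [pow_le_pow_left₀ hv0 hv1 2, sq_nonneg v, hv0, hv1, mul_nonneg hv0 (sq_nonneg v)]

/-- `e^{u} ≤ 1 + u + u²` for `0 ≤ u ≤ 1`. [folklore] -/
theorem exp_le_quadratic {u : ℝ} (hu0 : 0 ≤ u) (hu1 : u ≤ 1) : Real.exp u ≤ 1 + u + u ^ 2 := by
  have := Real.abs_exp_sub_one_sub_id_le (x := u) (by rw [abs_of_nonneg hu0]; exact hu1)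
  have := (abs_le.1 this).2
  linarith


/-! ### The analytic inequality of Case C3 -/

/-- **The analytic inequality behind Case C3** (ELSW §5 write `τ = n²mδ` and bound
`(1+n²/τ)^m + (1-n²/(n²+τ-1))^{n-k}` by `e^{1/δ} + e^{2/δ - n/(mδ)}`, "so we just need the first term to be
less than `2`, so we take, e.g. `δ = 3/2`"; the printed estimate is asymptotic in `m`). Explicit form used
here: for `M ≥ 10`, `S ≥ 20 M`, `0 < x`, `3 M x ≤ 2`: `e^{Mx} + e^{-Sx/(1+x)} < 2` (second-order Taylor for
`S x ≤ 1`; numerical bounds on `1 < Sx ≤ 6`, `6 < Sx ≤ 11`, `11 < Sx`). [cite: EfremenkoLandsbergSchenckWeyman2018, §5 (Case C3)] -/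
theorem exp_add_exp_lt_two {M S x : ℝ} (hM : 10 ≤ M) (hS : 20 * M ≤ S) (hx0 : 0 < x)
    (hx1 : 3 * M * x ≤ 2) : Real.exp (M * x) + Real.exp (-(S * x / (1 + x))) < 2 := by
  have hMpos : 0 < M := by linarith
  have hSpos : 0 < S := by linarith
  have hxle : x ≤ 1 / 15 := by nlinarith
  have hMx0 : 0 < M * x := mul_pos hMpos hx0
  have hSx0 : 0 < S * x := mul_pos hSpos hx0
  have hMx23 : M * x ≤ 2 / 3 := by nlinarith
  have hSMx : 20 * (M * x) ≤ S * x := by nlinarith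
  have hv : 15 / 16 * (S * x) ≤ S * x / (1 + x) := by
    rw [le_div_iff₀ (by linarith)]
    nlinarith
  have hv0 : 0 ≤ S * x / (1 + x) := by positivity
  have hmono : ∀ {a b : ℝ}, a ≤ b → Real.exp (-b) ≤ Real.exp (-a) := fun h =>
    Real.exp_le_exp.2 (neg_le_neg h)
  by_cases h1 : S * x ≤ 1
  · -- Taylor piece
    have hv1 : S * x / (1 + x) ≤ 1 := (div_le_self hSx0.le (by linarith)).trans h1
    have hA := exp_le_quadratic (u := M * x) hMx0.le (by linarith)
    have hB := exp_neg_le_taylor hv0 hv1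
    have hMx : M * x ≤ 1 / 20 := by linarith
    have hsq1 : (M * x) ^ 2 ≤ M * x * (1 / 20) := by
      rw [sq]; exact mul_le_mul_of_nonneg_left hMx hMx0.le
    have hsq2 : (S * x / (1 + x)) ^ 2 ≤ S * x / (1 + x) := by
      rw [sq]; exact mul_le_of_le_one_right hv0 hv1
    nlinarith
  · push Not at h1
    by_cases h2 : S * x ≤ 6
    · have hA : Real.exp (M * x) ≤ 1.35 :=
        (Real.exp_le_exp.2 (by linarith : M * x ≤ 3 / 10)).trans exp_three_tenths_le
      have hB : Real.exp (-(S * x / (1 + x))) ≤ 0.398 := by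
        refine (hmono (show (15 : ℝ) / 16 ≤ S * x / (1 + x) by linarith)).trans ?_
        refine (exp_neg_le_inv_cubic (by norm_num)).trans ?_
        norm_num
      linarith
    · push Not at h2
      by_cases h3 : S * x ≤ 11
      · have hA : Real.exp (M * x) ≤ 1.7334 :=
          (Real.exp_le_exp.2 (by linarith : M * x ≤ 11 / 20)).trans exp_eleven_twentieths_le
        have hB : Real.exp (-(S * x / (1 + x))) ≤ 0.02 := by
          refine (hmono (show (45 : ℝ) / 8 ≤ S * x / (1 + x) by linarith)).trans ?_
          refine (exp_neg_le_inv_cubic (by norm_num)).trans ?_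
          norm_num
        linarith
      · push Not at h3
        have hA : Real.exp (M * x) ≤ 1.9479 :=
          (Real.exp_le_exp.2 hMx23).trans exp_two_thirds_le
        have hB : Real.exp (-(S * x / (1 + x))) ≤ 0.005 := by
          refine (hmono (show (165 : ℝ) / 16 ≤ S * x / (1 + x) by linarith)).trans ?_
          refine (exp_neg_le_inv_cubic (by norm_num)).trans ?_
          norm_num
        linarith

/-! ### Ratios of binomial coefficients -/

/-- `binom(A+m, B+m) · ∏_{j<m} (B+1+j) = binom(A, B) · ∏_{j<m} (A+1+j)`, i.e.
`binom(A+m,B+m)/binom(A,B) = ∏_{j<m} (A+1+j)/(B+1+j)` (iterate `(n+1) binom(n,k) = binom(n+1,k+1) (k+1)`). [folklore] -/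
theorem choose_add_mul_prod (A B m : ℕ) :
    ((A + m).choose (B + m) : ℝ) * ∏ j ∈ Finset.range m, ((B : ℝ) + 1 + j) =
      (A.choose B : ℝ) * ∏ j ∈ Finset.range m, ((A : ℝ) + 1 + j) := by
  induction m with
  | zero => simp
  | succ m ih =>
    have key := Nat.add_one_mul_choose_eq (A + m) (B + m)
    have key' : ((A : ℝ) + m + 1) * ((A + m).choose (B + m) : ℝ) =
        ((A + (m + 1)).choose (B + (m + 1)) : ℝ) * ((B : ℝ) + m + 1) := by
      rw [show A + (m + 1) = A + m + 1 by ring, show B + (m + 1) = B + m + 1 by ring]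
      exact_mod_cast key
    rw [Finset.prod_range_succ, Finset.prod_range_succ]
    linear_combination (-(∏ j ∈ Finset.range m, ((B : ℝ) + 1 + j))) * key' +
      ((A : ℝ) + m + 1) * ih

end Analysis

/-! ### Case C3 -/

section CaseC3

open Real

/-- **The numerical inequality of Case C3**: for `m ≥ 10`, `s ≥ 20 m`, `s ≤ τ`, `N ≥ 2` and `3 N m ≤ 2 τ`:
`binom(N+m+τ-1, m+τ) + binom(N+τ-1-s, τ-s) < 2 binom(N+τ-1, τ)` — ELSW §5 "we need to show
`2 binom(n²+τ-1,τ) - binom(n²+τ+m-1, τ+m) - binom(n²+τ-(n-k)-1, τ-(n-k)) > 0`", proved with explicit constants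
(divide by `binom(N+τ-1,τ)`, bound the two ratios by `(1+x)^m ≤ e^{mx}` and `(1-y)^s ≤ e^{-sx/(1+x)}` with
`x = (N-1)/(τ+1)`, `y = (N-1)/(N+τ-1)`, then `exp_add_exp_lt_two`). [cite: EfremenkoLandsbergSchenckWeyman2018, §5 (Case C3)] -/
theorem choose_add_choose_lt_two_mul_choose {N m s τ : ℕ} (hm : 10 ≤ m) (hs : 20 * m ≤ s)
    (hsτ : s ≤ τ) (hN : 2 ≤ N) (hτ : 3 * N * m ≤ 2 * τ) :
    (N + m + τ - 1).choose (m + τ) + (N + τ - 1 - s).choose (τ - s) < 2 * (N + τ - 1).choose τ := by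
  -- work in ℝ
  have hD : 0 < ((N + τ - 1).choose τ : ℝ) := by
    exact_mod_cast Nat.choose_pos (by omega)
  -- the two ratios as products
  have hup := choose_add_mul_prod (N + τ - 1) τ m
  rw [show N + τ - 1 + m = N + m + τ - 1 by omega, show τ + m = m + τ by omega] at hup
  have hdown := choose_add_mul_prod (N + τ - 1 - s) (τ - s) s
  rw [show N + τ - 1 - s + s = N + τ - 1 by omega, show τ - s + s = τ by omega] at hdown
  -- positivity of the products
  have hPB : 0 < ∏ j ∈ Finset.range m, ((τ : ℝ) + 1 + j) :=
    Finset.prod_pos fun j _ => by positivity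
  have hPA' : 0 < ∏ j ∈ Finset.range s, (((N + τ - 1 - s : ℕ) : ℝ) + 1 + j) :=
    Finset.prod_pos fun j _ => by positivity
  -- x and the exponential bound
  set x : ℝ := ((N : ℝ) - 1) / ((τ : ℝ) + 1) with hx
  have hN1 : (1 : ℝ) ≤ (N : ℝ) - 1 := by
    have : (2 : ℝ) ≤ N := by exact_mod_cast hN
    linarith
  have hx0 : 0 < x := div_pos (by linarith) (by positivity)
  have hx1 : 3 * (m : ℝ) * x ≤ 2 := by
    rw [hx, mul_div_assoc', div_le_iff₀ (by positivity)]
    have : (3 * N * m : ℝ) ≤ 2 * τ := by exact_mod_cast hτ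
    nlinarith
  have hkey := exp_add_exp_lt_two (M := m) (S := s) (by exact_mod_cast hm) (by exact_mod_cast hs)
    hx0 hx1
  -- bound the first ratio: each factor ≤ 1 + x, so the product ≤ (1+x)^m ≤ exp (m x)
  have hA : ((N + m + τ - 1).choose (m + τ) : ℝ) ≤ ((N + τ - 1).choose τ : ℝ) * Real.exp (m * x) := by
    have h1 : ((N + m + τ - 1).choose (m + τ) : ℝ) =
        ((N + τ - 1).choose τ : ℝ) * ∏ j ∈ Finset.range m,
          ((((N + τ - 1 : ℕ) : ℝ) + 1 + j) / ((τ : ℝ) + 1 + j)) := by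
      rw [Finset.prod_div_distrib, mul_div_assoc', eq_div_iff hPB.ne', hup]
    rw [h1]
    refine mul_le_mul_of_nonneg_left ?_ hD.le
    calc ∏ j ∈ Finset.range m, ((((N + τ - 1 : ℕ) : ℝ) + 1 + j) / ((τ : ℝ) + 1 + j))
        ≤ ∏ _j ∈ Finset.range m, (1 + x) := by
          refine Finset.prod_le_prod (fun j _ => by positivity) fun j _ => ?_
          rw [div_le_iff₀ (by positivity), hx]
          have hτ1 : (0 : ℝ) < (τ : ℝ) + 1 := by positivity
          rw [show (1 + ((N : ℝ) - 1) / ((τ : ℝ) + 1)) = ((τ : ℝ) + 1 + ((N : ℝ) - 1)) / ((τ : ℝ) + 1)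
            by field_simp]
          rw [div_mul_eq_mul_div, le_div_iff₀ hτ1]
          have : (((N + τ - 1 : ℕ) : ℝ)) = (N : ℝ) + τ - 1 := by
            rw [Nat.cast_sub (by omega)]; push_cast; ring
          rw [this]
          have hj : (0 : ℝ) ≤ j := by positivity
          nlinarith
      _ = (1 + x) ^ m := by rw [Finset.prod_const, Finset.card_range]
      _ ≤ Real.exp x ^ m := by
          exact pow_le_pow_left₀ (by linarith) (by linarith [Real.add_one_le_exp x]) m
      _ = Real.exp (m * x) := by rw [← Real.exp_nat_mul]
  -- bound the second: each factor ≤ 1 - y ≤ exp (-(x/(1+x))), product ≤ exp(-(s x/(1+x)))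
  have hB : ((N + τ - 1 - s).choose (τ - s) : ℝ) ≤
      ((N + τ - 1).choose τ : ℝ) * Real.exp (-(s * x / (1 + x))) := by
    have h1 : ((N + τ - 1 - s).choose (τ - s) : ℝ) =
        ((N + τ - 1).choose τ : ℝ) * ∏ j ∈ Finset.range s,
          ((((τ - s : ℕ) : ℝ) + 1 + j) / (((N + τ - 1 - s : ℕ) : ℝ) + 1 + j)) := by
      rw [Finset.prod_div_distrib, mul_div_assoc', eq_div_iff hPA'.ne', ← hdown, mul_comm]
    rw [h1]
    refine mul_le_mul_of_nonneg_left ?_ hD.le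
    have hNτ : (0 : ℝ) < (N : ℝ) + τ - 1 := by
      have : (0 : ℝ) ≤ τ := by positivity
      linarith
    set y : ℝ := ((N : ℝ) - 1) / ((N : ℝ) + τ - 1) with hy
    have hy1 : 1 - y = (τ : ℝ) / ((N : ℝ) + τ - 1) := by
      rw [hy]; field_simp; ring
    have h1y0 : (0 : ℝ) ≤ 1 - y := by rw [hy1]; positivity
    have hcast1 : (((τ - s : ℕ) : ℝ)) = (τ : ℝ) - s := by rw [Nat.cast_sub hsτ]
    have hcast2 : (((N + τ - 1 - s : ℕ) : ℝ)) = (N : ℝ) + τ - 1 - s := by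
      rw [Nat.cast_sub (by omega), Nat.cast_sub (by omega)]; push_cast; ring
    calc ∏ j ∈ Finset.range s, ((((τ - s : ℕ) : ℝ) + 1 + j) / (((N + τ - 1 - s : ℕ) : ℝ) + 1 + j))
        ≤ ∏ _j ∈ Finset.range s, (1 - y) := by
          refine Finset.prod_le_prod (fun j _ => by positivity) fun j hj => ?_
          have hjs : (j : ℝ) + 1 ≤ s := by exact_mod_cast Finset.mem_range.1 hj
          rw [hy1, hcast1, hcast2, div_le_div_iff₀ (by linarith) hNτ]
          nlinarith
      _ = (1 - y) ^ s := by rw [Finset.prod_const, Finset.card_range]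
      _ ≤ Real.exp (-y) ^ s :=
          pow_le_pow_left₀ h1y0 (by linarith [Real.add_one_le_exp (-y)]) s
      _ = Real.exp (-(s * y)) := by rw [← Real.exp_nat_mul]; ring_nf
      _ ≤ Real.exp (-(s * x / (1 + x))) := by
          refine Real.exp_le_exp.2 (neg_le_neg ?_)
          rw [mul_div_assoc]
          refine mul_le_mul_of_nonneg_left ?_ (by positivity)
          have : x / (1 + x) = ((N : ℝ) - 1) / ((N : ℝ) + τ) := by
            rw [hx]; field_simp; ring
          rw [this, hy]
          exact div_le_div_of_nonneg_left (by linarith) hNτ (by linarith)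
  have hlt : ((N + m + τ - 1).choose (m + τ) : ℝ) + ((N + τ - 1 - s).choose (τ - s) : ℝ) <
      2 * ((N + τ - 1).choose τ : ℝ) := by
    have := mul_lt_mul_of_pos_left hkey hD
    linarith
  exact_mod_cast hlt

/-- **Case C3 of ELSW Thm. 1.5 (proved, explicit ranges)**: in characteristic zero, for `m ≥ 10`,
`n > 2m² + 2m`, orders `0 < k` with `2k < 3m` and shifts `τ ≥ (3/2) n² m` (`3 n² m ≤ 2 τ`):
`rank((ℓ^{n-m}perm_m)_{(k,n-k)[τ]}) < rank((det_n)_{(k,n-k)[τ]})`, by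
`rank P ≤ dim S^{m+τ} < 2 dim S^τ - dim S^{τ-(n-k)} ≤ rank(ℓ₁ⁿ ± ℓ₂ⁿ) ≤ rank det_n`. Printed range: "Case
`k < 2m` and `τ > (3/2)n²m`", `m > M` inexplicit; the tree's assembly uses the narrower order range `2k < 3m`
(the orders `3m ≤ 2k`, `k ≤ n - 2m + 1` go to Case C2) because with the printed constants Cases C3/C4 do
not overlap for `2m²+2m < n ≲ 3m²` (§1.3 says C4 holds for `τ < 6n³/m`, §6 proves `τ < n³/(6m)`).
[cite: EfremenkoLandsbergSchenckWeyman2018, Thm. 1.5, §1.3 and §5 (Case C3)] -/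
theorem caseC3 {K : Type*} [Field K] [CharZero K] {m n : ℕ} (hm : 10 ≤ m)
    (hn : 2 * m ^ 2 + 2 * m < n) [NeZero n] (k τ : ℕ) (hk0 : 0 < k) (hk : 2 * k < 3 * m)
    (hτ : 3 * n ^ 2 * m ≤ 2 * τ) :
    shiftedPartialsRank K k τ (paddedPerPoly K m n) <
      shiftedPartialsRank K k τ (Literature.Computability.AlgebraicComplexity.detPoly (Fin n) K) := by
  classical
  have hm2 : 20 * m ≤ 2 * m ^ 2 := by nlinarith
  have hs20 : 20 * m ≤ n - k := by omega
  have hkm : k + m ≤ n := by omega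
  have hn2 : 2 ≤ n := by omega
  have hN2 : 2 ≤ n ^ 2 := by nlinarith
  have hsτ : n - k ≤ τ := by
    have h2 : 2 * n ≤ n ^ 2 := by nlinarith
    have h3 : n ^ 2 ≤ 3 * n ^ 2 * m := by nlinarith
    omega
  -- the permanent side
  have hP := shiftedPartialsRank_paddedPerPoly_le_choose (K := K) (m := m) (n := n) (by omega) k τ hkm
  -- the determinant side
  set a : Fin n × Fin n := ((0 : Fin n), (0 : Fin n)) with ha
  set b : Fin n × Fin n := ((0 : Fin n), (1 : Fin n)) with hb
  have hab : a ≠ b := by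
    rw [ha, hb]
    intro h
    have := congrArg (fun v : Fin n × Fin n => v.2.val) h
    simp only [Fin.val_zero, Fin.val_one'] at this
    rw [Nat.one_mod_eq_one.2 (by omega)] at this
    exact absurd this (by norm_num)
  set c : K := (-1) ^ (n + 1) with hc
  have hc0 : c ≠ 0 := pow_ne_zero _ (neg_ne_zero.2 one_ne_zero)
  have hR : (X a ^ n + (-1) ^ (n + 1) * X b ^ n : MvPolynomial (Fin n × Fin n) K) =
      X a ^ n + c • X b ^ n := by
    rw [hc, MvPolynomial.smul_eq_C_mul, map_pow, map_neg, map_one]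
  have hmem := X_pow_add_mem_endOrbit (K := K) n hn2 a b
  rw [hR] at hmem
  have hmono := shiftedPartialsRank_le_of_mem_endOrbit hmem k τ
  have hlow := le_shiftedPartialsRank_two_powers (K := K) hab hc0 n k τ hk0 (by omega)
  rw [Fintype.card_prod, Fintype.card_fin, ← sq] at hlow
  -- the numerical inequality
  have hineq := choose_add_choose_lt_two_mul_choose (N := n ^ 2) (m := m) (s := n - k) (τ := τ) hm
    hs20 hsτ hN2 hτ
  have e1 : n ^ 2 + (m + τ) - 1 = n ^ 2 + m + τ - 1 := by omega
  have e2 : n ^ 2 + (τ - (n - k)) - 1 = n ^ 2 + τ - 1 - (n - k) := by omega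
  rw [e1] at hP
  rw [e2] at hlow
  omega

end CaseC3

end Literature.Barriers.ValiantsHypothesis
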